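import Literature.Geometry.Lorentzian.BoostedKerrSchildDecay

/-!
# Route EIHFluxBalance — `InertialRecession` (E′), K1 / stub `stub_coerMomKernel` (Bk), far field, part F2a:
# the derivative of the lab first-variation field `Var` in rest-frame terms (pure calculus)

Helper file for the crux `stmt-FinalStateConjecture-17403`. For a `C²` tensor field `K` (rest frame), a linear map
`Li` (lab → rest, `Li = Λ⁻¹`), an infinitesimal rest-frame motion `(A, d)` and the lab first-variation field
`V z := (∂_{A(Li z)+d} K)(Li z)(Li·,Li·) + K(Li z)(A Li·, Li·) + K(Li z)(Li·, A Li·)` (the `Var` of Bk with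
`K = Kerr.bilin M a`, `Li = L.symm`), we prove that `V` is differentiable and
**`∂_w V(a,b) = [∂_{E_w}∂_{X₀}K + ∂_{A E_w}K](E_a,E_b) + ∂_{E_w}K(A E_a,E_b) + ∂_{E_w}K(E_a,A E_b)`** at `y = Li x`,
`X₀ = A y + d`, `E_u = Li u` (`hasFDerivAt_lieVar`, `fderiv_lieVar_apply`), together with the bookkeeping identity
`fderiv (fun y ↦ fderiv K y X U W) y E = fderiv (fderiv K) y E X U W` (`fderiv_fderiv_apply₃`) and the specialisation to
`Kerr.bilin M a`, `poincareInv L 0` (`fderiv_kerrVar_apply`). No definitions, no `sorry`. [folklore]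
-/

set_option linter.dupNamespace false
-- instance search through the nested operator types (as in the skeleton / `ChartCurvature`)
set_option maxSynthPendingDepth 6
set_option synthInstance.maxHeartbeats 200000

noncomputable section

open scoped Topology
open Filter Set Function Literature.Geometry.Lorentzian

namespace Summit.FinalStateConjecture.FinalStateConjecture.Theorems.SublinearIsFree.Slaving

section General

variable {K : E4 → E4 →L[ℝ] E4 →L[ℝ] ℝ}

/-- Differentiating `y ↦ T(y)(A·, B·)` for constant `A, B`: the derivative is `u ↦ T′(u)(A·, B·)`. [folklore] -/
theorem hasFDerivAt_bilinearComp_const {T : E4 → E4 →L[ℝ] E4 →L[ℝ] ℝ} {T' : E4 →L[ℝ] E4 →L[ℝ] E4 →L[ℝ] ℝ} {y : E4}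
    (hT : HasFDerivAt T T' y) (A B : E4 →L[ℝ] E4) :
    HasFDerivAt (fun y ↦ (T y).bilinearComp A B)
      (((ContinuousLinearMap.compL ℝ E4 (E4 →L[ℝ] ℝ) (E4 →L[ℝ] ℝ)) ((ContinuousLinearMap.compL ℝ E4 E4 ℝ).flip B)).comp
        (((ContinuousLinearMap.compL ℝ E4 E4 (E4 →L[ℝ] ℝ)).flip A).comp T')) y := by
  have h1 := ((ContinuousLinearMap.compL ℝ E4 E4 (E4 →L[ℝ] ℝ)).flip A).hasFDerivAt.comp y hT
  have h2 := ((ContinuousLinearMap.compL ℝ E4 (E4 →L[ℝ] ℝ) (E4 →L[ℝ] ℝ))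
    ((ContinuousLinearMap.compL ℝ E4 E4 ℝ).flip B)).hasFDerivAt.comp y h1
  have hfun : (fun y ↦ (T y).bilinearComp A B) =
      (⇑((ContinuousLinearMap.compL ℝ E4 (E4 →L[ℝ] ℝ) (E4 →L[ℝ] ℝ)) ((ContinuousLinearMap.compL ℝ E4 E4 ℝ).flip B)) ∘
        (⇑((ContinuousLinearMap.compL ℝ E4 E4 (E4 →L[ℝ] ℝ)).flip A) ∘ T)) := by
    funext y; ext v w; simp
  rw [hfun]
  exact h2

/-- Evaluation commutes with the derivative: `∂_E (y ↦ ∂_X K(U,W)) = (∂∂K)(E)(X)(U)(W)` when `∂K` is differentiable. [folklore] -/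
theorem fderiv_fderiv_apply₃ {y : E4} (hK : DifferentiableAt ℝ (fderiv ℝ K) y) (X U W E : E4) :
    fderiv ℝ (fun y' ↦ fderiv ℝ K y' X U W) y E = fderiv ℝ (fderiv ℝ K) y E X U W := by
  have h1 : fderiv ℝ (fun y' ↦ fderiv ℝ K y' X) y = (fderiv ℝ (fderiv ℝ K) y).flip X := by
    rw [fderiv_clm_apply hK (differentiableAt_const X)]; simp
  have hd1 : DifferentiableAt ℝ (fun y' ↦ fderiv ℝ K y' X) y := hK.clm_apply (differentiableAt_const X)
  have h2 : fderiv ℝ (fun y' ↦ fderiv ℝ K y' X U) y = (fderiv ℝ (fun y' ↦ fderiv ℝ K y' X) y).flip U := by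
    rw [fderiv_clm_apply hd1 (differentiableAt_const U)]; simp
  have hd2 : DifferentiableAt ℝ (fun y' ↦ fderiv ℝ K y' X U) y := hd1.clm_apply (differentiableAt_const U)
  have h3 : fderiv ℝ (fun y' ↦ fderiv ℝ K y' X U W) y = (fderiv ℝ (fun y' ↦ fderiv ℝ K y' X U) y).flip W := by
    rw [fderiv_clm_apply hd2 (differentiableAt_const W)]; simp
  rw [h3, ContinuousLinearMap.flip_apply, h2, ContinuousLinearMap.flip_apply, h1, ContinuousLinearMap.flip_apply]

variable (K)

/-- **The lab first-variation field is differentiable, with rest-frame derivative** (CLM form). For `K` `C²` at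
`y = Li x`: `V = Φ ∘ Li` with `Φ(y') = (∂_{Ay'+d}K)(y')(Li·,Li·) + K(y')(ALi·,Li·) + K(y')(Li·,ALi·)`. [folklore] -/
theorem hasFDerivAt_lieVar (Li A : E4 →L[ℝ] E4) (d : E4) {x : E4} (hK : ContDiffAt ℝ 2 K (Li x)) :
    HasFDerivAt (fun z : E4 ↦ (fderiv ℝ K (Li z) (A (Li z) + d)).bilinearComp Li Li +
        (K (Li z)).bilinearComp (A.comp Li) Li + (K (Li z)).bilinearComp Li (A.comp Li))
      ((((ContinuousLinearMap.compL ℝ E4 (E4 →L[ℝ] ℝ) (E4 →L[ℝ] ℝ)) ((ContinuousLinearMap.compL ℝ E4 E4 ℝ).flip Li)).comp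
          (((ContinuousLinearMap.compL ℝ E4 E4 (E4 →L[ℝ] ℝ)).flip Li).comp
            ((fderiv ℝ K (Li x)).comp A + (fderiv ℝ (fderiv ℝ K) (Li x)).flip (A (Li x) + d))) +
        ((ContinuousLinearMap.compL ℝ E4 (E4 →L[ℝ] ℝ) (E4 →L[ℝ] ℝ)) ((ContinuousLinearMap.compL ℝ E4 E4 ℝ).flip Li)).comp
          (((ContinuousLinearMap.compL ℝ E4 E4 (E4 →L[ℝ] ℝ)).flip (A.comp Li)).comp (fderiv ℝ K (Li x))) +
        ((ContinuousLinearMap.compL ℝ E4 (E4 →L[ℝ] ℝ) (E4 →L[ℝ] ℝ)) ((ContinuousLinearMap.compL ℝ E4 E4 ℝ).flip (A.comp Li))).comp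
          (((ContinuousLinearMap.compL ℝ E4 E4 (E4 →L[ℝ] ℝ)).flip Li).comp (fderiv ℝ K (Li x)))).comp Li) x := by
  set y := Li x with hy
  have hK1 : DifferentiableAt ℝ K y := hK.differentiableAt (by norm_num)
  have hK2 : DifferentiableAt ℝ (fderiv ℝ K) y :=
    (hK.fderiv_right (m := 1) (by norm_num)).differentiableAt one_ne_zero
  -- the three terms of Φ
  have hu : HasFDerivAt (fun y' : E4 ↦ A y' + d) A y := (A.hasFDerivAt).add_const d
  have h1 : HasFDerivAt (fun y' ↦ fderiv ℝ K y' (A y' + d))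
      ((fderiv ℝ K y).comp A + (fderiv ℝ (fderiv ℝ K) y).flip (A y + d)) y := hK2.hasFDerivAt.clm_apply hu
  have hΦ := ((hasFDerivAt_bilinearComp_const h1 Li Li).add
    (hasFDerivAt_bilinearComp_const hK1.hasFDerivAt (A.comp Li) Li)).add
    (hasFDerivAt_bilinearComp_const hK1.hasFDerivAt Li (A.comp Li))
  exact hΦ.comp x Li.hasFDerivAt

/-- **The derivative of the lab first-variation field in rest-frame terms**:
`∂_w V(a,b) = [∂_{E_w}∂_{X₀}K + ∂_{A E_w}K](E_a,E_b) + ∂_{E_w}K(A E_a,E_b) + ∂_{E_w}K(E_a,A E_b)`, `y = Li x`,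
`X₀ = Ay + d`, `E_u = Li u`. [folklore] -/
theorem fderiv_lieVar_apply (Li A : E4 →L[ℝ] E4) (d : E4) {x : E4} (hK : ContDiffAt ℝ 2 K (Li x)) (w a b : E4) :
    fderiv ℝ (fun z : E4 ↦ (fderiv ℝ K (Li z) (A (Li z) + d)).bilinearComp Li Li +
        (K (Li z)).bilinearComp (A.comp Li) Li + (K (Li z)).bilinearComp Li (A.comp Li)) x w a b =
      fderiv ℝ (fun y' ↦ fderiv ℝ K y' (A (Li x) + d) (Li a) (Li b)) (Li x) (Li w) +
        fderiv ℝ K (Li x) (A (Li w)) (Li a) (Li b) +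
        fderiv ℝ K (Li x) (Li w) (A (Li a)) (Li b) + fderiv ℝ K (Li x) (Li w) (Li a) (A (Li b)) := by
  have hK2 : DifferentiableAt ℝ (fderiv ℝ K) (Li x) :=
    (hK.fderiv_right (m := 1) (by norm_num)).differentiableAt one_ne_zero
  rw [(hasFDerivAt_lieVar K Li A d hK).fderiv, fderiv_fderiv_apply₃ hK2]
  simp only [ContinuousLinearMap.comp_apply, FunLike.coe_add, Pi.add_apply, ContinuousLinearMap.compL_apply,
    ContinuousLinearMap.flip_apply]
  ring

end General

/-- **Specialisation to Bk's `Var`**: `K = Kerr.bilin M a`, lab chart `poincareInv L 0 = L⁻¹`, at a lab point whose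
rest image is off the ring singularity (`0 < r`). [folklore] -/
theorem fderiv_kerrVar_apply (M a : ℝ) (L : lorentzGroup) (A : E4 →L[ℝ] E4) (d : E4) {x : E4}
    (hx : 0 < Kerr.radius a (poincareInv L 0 x)) (w u b : E4) :
    fderiv ℝ (fun z : E4 ↦ (fderiv ℝ (Kerr.bilin M a) (poincareInv L 0 z) (A (poincareInv L 0 z) + d)).bilinearComp
          (((L : E4 ≃L[ℝ] E4).symm : E4 →L[ℝ] E4)) (((L : E4 ≃L[ℝ] E4).symm : E4 →L[ℝ] E4)) +
        (Kerr.bilin M a (poincareInv L 0 z)).bilinearComp (A.comp (((L : E4 ≃L[ℝ] E4).symm : E4 →L[ℝ] E4)))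
          (((L : E4 ≃L[ℝ] E4).symm : E4 →L[ℝ] E4)) +
        (Kerr.bilin M a (poincareInv L 0 z)).bilinearComp (((L : E4 ≃L[ℝ] E4).symm : E4 →L[ℝ] E4))
          (A.comp (((L : E4 ≃L[ℝ] E4).symm : E4 →L[ℝ] E4)))) x w u b =
      fderiv ℝ (fun y' ↦ fderiv ℝ (Kerr.bilin M a) y' (A (poincareInv L 0 x) + d) ((L : E4 ≃L[ℝ] E4).symm u)
          ((L : E4 ≃L[ℝ] E4).symm b)) (poincareInv L 0 x) ((L : E4 ≃L[ℝ] E4).symm w) +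
        fderiv ℝ (Kerr.bilin M a) (poincareInv L 0 x) (A ((L : E4 ≃L[ℝ] E4).symm w)) ((L : E4 ≃L[ℝ] E4).symm u)
          ((L : E4 ≃L[ℝ] E4).symm b) +
        fderiv ℝ (Kerr.bilin M a) (poincareInv L 0 x) ((L : E4 ≃L[ℝ] E4).symm w) (A ((L : E4 ≃L[ℝ] E4).symm u))
          ((L : E4 ≃L[ℝ] E4).symm b) +
        fderiv ℝ (Kerr.bilin M a) (poincareInv L 0 x) ((L : E4 ≃L[ℝ] E4).symm w) ((L : E4 ≃L[ℝ] E4).symm u)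
          (A ((L : E4 ≃L[ℝ] E4).symm b)) := by
  have hp : ∀ z : E4, poincareInv L 0 z = (((L : E4 ≃L[ℝ] E4).symm : E4 →L[ℝ] E4)) z := fun z ↦ by
    rw [poincareInv_zero]; rfl
  have hK : ContDiffAt ℝ 2 (Kerr.bilin M a) ((((L : E4 ≃L[ℝ] E4).symm : E4 →L[ℝ] E4)) x) := by
    rw [← hp]; exact Kerr.contDiffAt_bilin M a hx
  simp only [hp]
  rw [fderiv_lieVar_apply (Kerr.bilin M a) _ A d hK]
  rfl

/-- Registered carrier `slaving_farFieldVarCalculus_slaving12` of the crux item (= `fderiv_fderiv_apply₃`). [folklore] -/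
theorem slaving_farFieldVarCalculus_slaving12 : ∀ {K : E4 → E4 →L[ℝ] E4 →L[ℝ] ℝ} {y : E4}, DifferentiableAt ℝ (fderiv ℝ K) y → ∀ X U W E : E4, fderiv ℝ (fun y' ↦ fderiv ℝ K y' X U W) y E = fderiv ℝ (fderiv ℝ K) y E X U W :=
  fun hK X U W E ↦ fderiv_fderiv_apply₃ hK X U W E

end Summit.FinalStateConjecture.FinalStateConjecture.Theorems.SublinearIsFree.Slaving
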